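import Literature.MathematicalPhysics.QuantumFieldTheory.Balaban1983to89.T4ShellMeasureLevels
import Literature.MathematicalPhysics.QuantumFieldTheory.Balaban1983to89.T4ShellCount
import HarnessLib

/-!
# YM-DAG node N21 (= NE7c) KNIT BY NAME — the single-run shell-weight bound
# `T4IndicatorShell.ShellWeightBound l₀ T A B shA shB Wsh` assembled from the typed interfaces of its in-edges
# N12 ([B15] p. 193 lowered-threshold template) · N16 (NE3 species, the two-run width (F∞)) · N20 (NE7b machinery:
# window, counts, survival arithmetic), at EXPLICIT term-class carriers

Track A of `YM-PLAN.md` (cell `pub-ymgap`, HUMAN RULING D-0062), node **N21** of 28, cluster K5 «SpineMatching» of the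
detail route `Summit.QuantumFields.YangMills.Theses.BalabanUVNodes` (item `SpineGivenEndpoint`; the node's future stub is
`S_N21 SRec := ∀ F D g₀ os S, SRec F D g₀ os S → ShellWeightBound S.l₀ S.T S.A S.B S.shA S.shB S.Wsh` of the staged
tree-home module `BalabanUVNodesClusters`, dagwriter g74∕g76).  Seat `pub-ymgap-dag-n21-a` (KNIT-BY-NAME).

HONEST FRAMING.  NE7c is NOT PRINTED in [Bałaban 1983–89] (the manuscripts construct ONE run; the two-run threshold
shells exist only in the cell's matching scheme, `T4IndicatorShell` design (i)) and is NOT PROVED here.  This module is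
kernel bookkeeping: 0 `def`, 0 `sorry`, standard axioms; every estimate-shaped input is a DISPLAYED hypothesis named
after the DAG in-edge that owes it; nothing of Bałaban's is asserted.  One finite four-torus programme at fixed `ε` —
NOT infinite volume, NOT ℝ⁴, NOT OS axioms, NOT a mass gap, NOT Clay.  A landing of this file is COUNT-NEUTRAL: the
term-class carriers OF RECORD (NODE 00 Stage 5 ∕ NODE O: Bałaban's (2.18) expansion as a Lean object) do not exist in
the tree, so the node is knit at EXPLICIT carriers `(l₀, T, A, B, shA, shB, Wsh)`; the day the record predicate `SRec`
lands, `stub_N21` is the three-line corollary «apply the knit to the record's ledger data».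

THE STATEMENT OF RECORD (YM-PLAN §2c row NE7c; `T4IndicatorShell.lean` :403).  `ShellWeightBound l₀ T A B shA shB Wsh`:
the shell parts `0 ≤ shA ≤ A`, `0 ≤ shB ≤ B` of the two runs' term weights have total relative weight `≤ Wsh K` IN
EACH RUN SEPARATELY, `0 ≤ Wsh`, `Σ_K Wsh K < ∞`.  Consumer: field `shell` of `T4MatchingAssembly.HybridNE7` (with N20's
`RelWeightBound` and `W + Wsh < 1`: `T4IndicatorShell.relWeightBound_ref` ∕ `cauchy_of_relWeightBound_shell`) → N19∕N27.

THE IN-EDGES AND WHERE EACH ENTERS (YM-PLAN §2c: «N12 ([B15] p. 193 template), NE3 (F∞) from N16, NE7b machinery (N20)»).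
* [dict] (NODE O ∕ Stage 5, not an estimate): the run's expansion read as nonnegative terms with per-slot shell pieces —
  fields `sh_nonneg`, `sh_le`, `cover` of `T4ShellMeasureLevels.LevelLedger` (road I) ∕ `piece_nonneg`, `piece_le` of
  `T4ShellCount.AgeLedger` and the union bounds `hAu hBu` (road II).
* N12 — [Balaban1989LargeFieldI] p. 193 «for any extension we have |∂U_{k,Z} − 1| ≥ 2ε_kη² … This condition is enough
  to get the exponential small factor … Thus 1 − χ_{k,Λ} is a large field function»: the SINGLE-RUN mechanism by which
  the shell below a threshold (= the large-field event at the LOWERED threshold cut by the slot's own small-field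
  function, `T4ShellCount.shellBelow_eq_largeInd_mul_smallInd`) is weighed — road I: the per-slot anti-concentration
  CONSTANT `D_j ≤ D̄` in the field `slot` of `LevelLedger` (`T4ShellMeasure.slot_field_of_antiConcentration`); road II:
  the age-indexed suppression factor `exp(−p a)` of `T4ShellCount.LevelGain` (printed SHAPE
  `T4ShellCount.LoweredThresholdSuppression`, [Balaban1989LargeFieldII] (1.79) p. 383 per created region).
* N16 — NE3 species, the two-run sup-closeness WIDTH (F∞) `ρ_j ≤ c₁ϑ^j` of the tested background variables at level `j`
  (node U1b; NOT PRINTED — [B11] prints η-uniform regularity only): road I: `hrateA hrateB`; road II: the LEVEL GAIN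
  `y (K − a)`, `Σ_j y j < ∞`, of `T4ShellCount.LevelGain` — by `T4ShellCount.not_summable_of_printedShapes_saturated` the
  field `ShellWeightBound.summable` is OUT OF REACH of N12's age-only template without it (the route's WALL, by name).
* N20 — NE7b machinery ([B16] (1.79)–(1.89) pp. 383–387 survival arithmetic; here its counting half): the bounded live
  window `N₁` and the per-level slot count `ν̄` (`T4ShellMeasureLevels.LiveWindow`, [Balaban1989LargeFieldI] (1.2)
  p. 178, window after (1.94) p. 198) — road I; the cube counts `n a ≤ V·Λ^a` (`T4ShellCount.CubeCount`,
  [Balaban1988Convergent] (2.17) p. 257: one small-field slot per `LM₂R`-cube per live level) — road II.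

WHAT IS PROVED ([folklore] arithmetic on the landed structures, BY NAME).
§0 glue on the statement of record: `shellWeightBound_mono` (any pointwise-larger summable weight), `_of_le_geometric`.
§1 ROAD I (shell-measure route, smooth members): `n21_knit_levels` = `T4ShellMeasureLevels.shellWeightBound_of_levels`
  ∘ `omega_add_le` ∘ §0 — conclusion `ShellWeightBound l₀ T A B shA shB Wsh` for ANY summable `Wsh` dominating the
  explicit geometric weight `2((N₁+1)ν̄D̄c₁ϑ^{−N₁})ϑ^K`; `n21_knit_levels_geometric` (that weight itself).
§2 ROAD II (count × suppression with a level gain): `n21_knit_ages` = `T4ShellCount.shellWeightBound_of_ageLedger` at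
  `s a = exp(−p a)` — weight `K ↦ Σ_{a ≤ N} n_a·e^{−p a}·y(K − a)`; `n21_knit_ages_tsum_le` its explicit total
  `≤ V·(Σ_{a ≤ N} Λ^a e^{−p a})·Σ_j y j` under the cube count; `n21_knit_ages_slot` (§0 to a dominating record weight).
§3 NON-VACUITY (referee vacuity guard): both knits FIRE on explicit data with nonempty classes, unit weights and
  NONZERO shells `ϑ^K` (`n21_knit_levels_nonvacuous`, `n21_knit_ages_nonvacuous`): the binder lists are jointly
  satisfiable with a non-trivial conclusion (`Wsh K = 2ϑ^K`).  The content of NE7c is in the binders, not here.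

NOT KNIT HERE (named for the planner).  (a) The MEASURE-LEVEL form of road I is END-I
`Summit.QuantumFields.BalabanUV.T4Continuum.ShellMeasureRootComposition.shellWeightBound_of_slotAC` (= two
`levelLedger_of_slotAC` + `shellWeightBound_of_levels`): there N12's slot is THE WALL (M1)
`T4ShellMeasure.SlotAntiConcentration (μ K t s) (u K t s) θ_j ρ_j D_j` per live slot — the first estimate with no
discharger at levels `j ≥ 1` (level 0 for `SU(2)`: `ShellMeasureWilsonRealizedSU2.slotAntiConcentration_wilson_su2`); its
age-synchronised re-typing is `ShellMeasureRootCompositionSync.shellWeightBound_of_towerData_sync`, and the one call of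
record over realized tower data is `ShellMeasureLiveEndOneCallUnionLevelsCfLinJunction.shellWeightBound_live_oneCall_…`
(p241094).  (b) ROAD (δ) (threshold averaging ∕ live factor, `T4ShellMeasure` §6–§8, `Spine/NE7c/LiveFactorGlobalCompact.
shellWeightBound_of_globalCompact`, `…LiveFactorJointLawModel.shellWeightBound_jointLaw`) needs NO (M1): it consumes only
σ-additivity, the closeness radii `2ρ ≤ c₁ϑ^K` (N16) and the counts (N20) — on that road the in-edge N12 is IDLE, at the
price of choosing the (deliberately non-sharp, [Balaban1989LargeFieldI] p. 181) thresholds from a candidate ladder by ONE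
global assignment; its wall is the term object (NODE O), not an estimate.  Either road closes `stub_N21` the day the
record predicate names which expansion and which thresholds are «of record».
-/

set_option autoImplicit false

noncomputable section

open Finset

namespace Summit.QuantumFields.YangMills.Theorems

open Literature.MathematicalPhysics.QuantumFieldTheory.Balaban1983to89
open T4IndicatorShell (ShellWeightBound)
open T4ShellMeasureLevels (LevelLedger LiveWindow shellWeightBound_of_levels omega_add_le)
open T4ShellCount (AgeLedger LevelGain CubeCount ageWeight shellWeightBound_of_ageLedger tsum_le_of_levelGain)

/-! ## §0 Glue on the statement of record -/

section Glue

variable {ι : Type*} {l₀ : ℝ} {T : ℕ → Finset ι} {A B shA shB : ℕ → ℝ → ι → ℝ} {Wsh Wsh' : ℕ → ℝ}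

/-- **Monotonicity of NE7c in its weight slot.**  A shell-weight bound with weights `Wsh` is one with any pointwise
larger SUMMABLE weights `Wsh'` (the run totals are nonnegative because `0 ≤ sh ≤` weight term-wise).  This is the glue
by which any road's explicit weight feeds the record's slot `S.Wsh`. [folklore] -/
theorem shellWeightBound_mono (h : ShellWeightBound l₀ T A B shA shB Wsh) (hle : ∀ K, Wsh K ≤ Wsh' K)
    (hsum : Summable Wsh') : ShellWeightBound l₀ T A B shA shB Wsh' where
  nonneg K := (h.nonneg K).trans (hle K)
  summable := hsum
  sh_nonneg_left := h.sh_nonneg_left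
  sh_le_left := h.sh_le_left
  sh_nonneg_right := h.sh_nonneg_right
  sh_le_right := h.sh_le_right
  left K t ht := (h.left K t ht).trans (mul_le_mul_of_nonneg_right (hle K)
    (sum_nonneg fun τ hτ => (h.sh_nonneg_left K t ht τ hτ).trans (h.sh_le_left K t ht τ hτ)))
  right K t ht := (h.right K t ht).trans (mul_le_mul_of_nonneg_right (hle K)
    (sum_nonneg fun τ hτ => (h.sh_nonneg_right K t ht τ hτ).trans (h.sh_le_right K t ht τ hτ)))

/-- … in particular under a geometric majorant `Wsh K ≤ C·ϑ^K`, `0 ≤ ϑ < 1`, the closed-form weight `C·ϑ^K` is a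
shell-weight bound (the shape U4′ `W + Wsh < 1` is read against). [folklore] -/
theorem shellWeightBound_of_le_geometric (h : ShellWeightBound l₀ T A B shA shB Wsh) {C ϑ : ℝ} (hϑ0 : 0 ≤ ϑ)
    (hϑ1 : ϑ < 1) (hC : ∀ K, Wsh K ≤ C * ϑ ^ K) : ShellWeightBound l₀ T A B shA shB fun K => C * ϑ ^ K :=
  shellWeightBound_mono h hC ((summable_geometric_of_lt_one hϑ0 hϑ1).mul_left C)

end Glue

/-! ## §1 ROAD I — the shell-measure route: two level ledgers, live windows, the (F∞)-rate -/

section RoadI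

variable {ι σA σB : Type*} {l₀ : ℝ} {T : ℕ → Finset ι} {A B shA shB : ℕ → ℝ → ι → ℝ}
  {SA : ℕ → Finset σA} {SB : ℕ → Finset σB} {pieceA : ℕ → ℝ → σA → ι → ℝ} {pieceB : ℕ → ℝ → σB → ι → ℝ}
  {lvlA : ℕ → σA → ℕ} {lvlB : ℕ → σB → ℕ} {DA ρA DB ρB : ℕ → ℝ} {N₁ : ℕ} {νbar Dbar c₁ ϑ : ℝ}

/-- **N21 KNIT, ROAD I.**  At explicit term-class carriers `(l₀, T, A, B, shA, shB)` of the two runs of every comparison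
`K`: [dict] + N12's per-slot constants by level = the two `LevelLedger`s; N20's window∕count = the two `LiveWindow`s;
N12's uniform constant bound `D ≤ D̄`; N16's (F∞)-rate `ρ_j ≤ c₁ϑ^j`, `0 < ϑ < 1` ⇒ `ShellWeightBound l₀ T A B shA shB Wsh`
for EVERY summable weight slot `Wsh` dominating the explicit geometric weight `2·((N₁+1)·ν̄·D̄·c₁·ϑ^{−N₁})·ϑ^K`
(`T4ShellMeasureLevels.shellWeightBound_of_levels` + `omega_add_le` + `shellWeightBound_mono`).  CONDITIONAL on every
displayed binder; NE7c NOT proved. [folklore] -/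
theorem n21_knit_levels (hA : LevelLedger l₀ T A shA SA pieceA lvlA DA ρA)
    (hB : LevelLedger l₀ T B shB SB pieceB lvlB DB ρB)
    (hwA : LiveWindow SA lvlA N₁ νbar) (hwB : LiveWindow SB lvlB N₁ νbar)
    (hDA : ∀ j, DA j ≤ Dbar) (hDB : ∀ j, DB j ≤ Dbar)
    (hϑ0 : 0 < ϑ) (hϑ1 : ϑ < 1) (hrateA : ∀ j, ρA j ≤ c₁ * ϑ ^ j) (hrateB : ∀ j, ρB j ≤ c₁ * ϑ ^ j)
    {Wsh : ℕ → ℝ} (hWsh : ∀ K, (2 * ((N₁ + 1) * νbar * Dbar * c₁ * ϑ⁻¹ ^ N₁)) * ϑ ^ K ≤ Wsh K)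
    (hsum : Summable Wsh) : ShellWeightBound l₀ T A B shA shB Wsh :=
  shellWeightBound_mono (shellWeightBound_of_levels hA hB hwA hwB hϑ0 hϑ1 hDA hDB hrateA hrateB)
    (fun K => (omega_add_le hA hB hwA hwB hϑ0 hϑ1.le hDA hDB hrateA hrateB K).trans (hWsh K)) hsum

/-- Road I with the closed-form geometric weight `Wsh K = 2·((N₁+1)·ν̄·D̄·c₁·ϑ^{−N₁})·ϑ^K` itself. [folklore] -/
theorem n21_knit_levels_geometric (hA : LevelLedger l₀ T A shA SA pieceA lvlA DA ρA)
    (hB : LevelLedger l₀ T B shB SB pieceB lvlB DB ρB)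
    (hwA : LiveWindow SA lvlA N₁ νbar) (hwB : LiveWindow SB lvlB N₁ νbar)
    (hDA : ∀ j, DA j ≤ Dbar) (hDB : ∀ j, DB j ≤ Dbar)
    (hϑ0 : 0 < ϑ) (hϑ1 : ϑ < 1) (hrateA : ∀ j, ρA j ≤ c₁ * ϑ ^ j) (hrateB : ∀ j, ρB j ≤ c₁ * ϑ ^ j) :
    ShellWeightBound l₀ T A B shA shB fun K => (2 * ((N₁ + 1) * νbar * Dbar * c₁ * ϑ⁻¹ ^ N₁)) * ϑ ^ K :=
  shellWeightBound_of_le_geometric (shellWeightBound_of_levels hA hB hwA hwB hϑ0 hϑ1 hDA hDB hrateA hrateB)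
    hϑ0.le hϑ1 (omega_add_le hA hB hwA hwB hϑ0 hϑ1.le hDA hDB hrateA hrateB)

end RoadI

/-! ## §2 ROAD II — count × lowered-threshold suppression WITH a level gain (age ledgers) -/

section RoadII

variable {ι : Type*} {l₀ : ℝ} {T : ℕ → Finset ι} {A B shA shB : ℕ → ℝ → ι → ℝ} {N : ℕ} {n : ℕ → ℕ}
  {shAs shBs : (Σ _ : ℕ, ℕ) → ℕ → ℝ → ι → ℝ} {x : ℕ → ℕ → ℝ} {p y : ℕ → ℝ} {V Λ : ℝ}

/-- **N21 KNIT, ROAD II.**  At explicit carriers: [dict] = the two runs' AGE LEDGERS over the bounded live window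
(ages `a ≤ N`, `n a` slots of age `a`, per-slot shell pieces `shXs`, common per-age ratios `x a K`) and the union bounds
of the total shell parts by the slot pieces; N12 ⊗ N16 = `LevelGain N x p y` (the per-slot ratio of age `a` at run `K`
is `≤ e^{−p a}·y(K − a)`: N12's lowered-threshold suppression of the creation age TIMES N16's level-anchored summable
gain) ⇒ `ShellWeightBound` with weight `K ↦ Σ_{a ≤ N} n_a·(e^{−p a}·y(K − a))`
(`T4ShellCount.shellWeightBound_of_ageLedger`).  CONDITIONAL on every displayed binder; NE7c NOT proved. [folklore] -/
theorem n21_knit_ages (hLA : AgeLedger l₀ T A N n shAs x) (hLB : AgeLedger l₀ T B N n shBs x)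
    (hA0 : ∀ K t, |t| ≤ l₀ → ∀ τ ∈ T K, 0 ≤ shA K t τ) (hAle : ∀ K t, |t| ≤ l₀ → ∀ τ ∈ T K, shA K t τ ≤ A K t τ)
    (hAu : ∀ K t, |t| ≤ l₀ → ∀ τ ∈ T K,
      shA K t τ ≤ ∑ σ ∈ (range (N + 1)).sigma (fun a => range (n a)), shAs σ K t τ)
    (hB0 : ∀ K t, |t| ≤ l₀ → ∀ τ ∈ T K, 0 ≤ shB K t τ) (hBle : ∀ K t, |t| ≤ l₀ → ∀ τ ∈ T K, shB K t τ ≤ B K t τ)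
    (hBu : ∀ K t, |t| ≤ l₀ → ∀ τ ∈ T K,
      shB K t τ ≤ ∑ σ ∈ (range (N + 1)).sigma (fun a => range (n a)), shBs σ K t τ)
    (hg : LevelGain N x p y) :
    ShellWeightBound l₀ T A B shA shB fun K => ∑ a ∈ range (N + 1), (n a : ℝ) * (Real.exp (-p a) * y (K - a)) :=
  shellWeightBound_of_ageLedger hLA hLB (fun _ _ => (Real.exp_pos _).le) hg.2.1 hg.2.2 (fun a ha K => (hg.1 a ha K).2)
    hA0 hAle hAu hB0 hBle hBu

/-- Road II's weight IS the age-ledger weight of the majorant ratios `e^{−p a}·y(K − a)` (definitional). [folklore] -/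
theorem n21_knit_ages_weight_eq (K : ℕ) :
    (∑ a ∈ range (N + 1), (n a : ℝ) * (Real.exp (-p a) * y (K - a))) =
      ageWeight N (fun a => (n a : ℝ)) (fun a K => Real.exp (-p a) * y (K - a)) K := rfl

/-- **The explicit total of road II under N20's cube count** `n a ≤ V·Λ^a`: when no slot older than the run is charged
(`y` vanishes off the band, `K < a`), `Σ_K Wsh K ≤ V·(Σ_{a ≤ N} Λ^a e^{−p a})·Σ_j y j` — the window entropy is paid ONCE
(`T4ShellCount.tsum_le_of_levelGain` at the majorant ratios). [folklore] -/
theorem n21_knit_ages_tsum_le (hc : CubeCount N n V Λ) (hg : LevelGain N x p y)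
    (hoff : ∀ a ≤ N, ∀ K, K < a → y (K - a) ≤ 0) :
    ∑' K, (∑ a ∈ range (N + 1), (n a : ℝ) * (Real.exp (-p a) * y (K - a))) ≤
      (V * ∑ a ∈ range (N + 1), Λ ^ a * Real.exp (-p a)) * ∑' j, y j := by
  have hg' : LevelGain N (fun a K => Real.exp (-p a) * y (K - a)) p y :=
    ⟨fun a _ K => ⟨mul_nonneg (Real.exp_pos _).le (hg.2.1 _), le_rfl⟩, hg.2.1, hg.2.2⟩
  have hoff' : ∀ a ≤ N, ∀ K, K < a → Real.exp (-p a) * y (K - a) ≤ 0 := fun a ha K hK =>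
    mul_nonpos_iff.2 (Or.inl ⟨(Real.exp_pos _).le, hoff a ha K hK⟩)
  exact tsum_le_of_levelGain hc hg' hoff'

/-- Road II into the record's weight slot: any summable `Wsh` dominating `Σ_{a ≤ N} n_a·e^{−p a}·y(K − a)`. [folklore] -/
theorem n21_knit_ages_slot (hLA : AgeLedger l₀ T A N n shAs x) (hLB : AgeLedger l₀ T B N n shBs x)
    (hA0 : ∀ K t, |t| ≤ l₀ → ∀ τ ∈ T K, 0 ≤ shA K t τ) (hAle : ∀ K t, |t| ≤ l₀ → ∀ τ ∈ T K, shA K t τ ≤ A K t τ)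
    (hAu : ∀ K t, |t| ≤ l₀ → ∀ τ ∈ T K,
      shA K t τ ≤ ∑ σ ∈ (range (N + 1)).sigma (fun a => range (n a)), shAs σ K t τ)
    (hB0 : ∀ K t, |t| ≤ l₀ → ∀ τ ∈ T K, 0 ≤ shB K t τ) (hBle : ∀ K t, |t| ≤ l₀ → ∀ τ ∈ T K, shB K t τ ≤ B K t τ)
    (hBu : ∀ K t, |t| ≤ l₀ → ∀ τ ∈ T K,
      shB K t τ ≤ ∑ σ ∈ (range (N + 1)).sigma (fun a => range (n a)), shBs σ K t τ)
    (hg : LevelGain N x p y) {Wsh : ℕ → ℝ}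
    (hWsh : ∀ K, ∑ a ∈ range (N + 1), (n a : ℝ) * (Real.exp (-p a) * y (K - a)) ≤ Wsh K) (hsum : Summable Wsh) :
    ShellWeightBound l₀ T A B shA shB Wsh :=
  shellWeightBound_mono (n21_knit_ages hLA hLB hA0 hAle hAu hB0 hBle hBu hg) hWsh hsum

end RoadII

/-! ## §3 Non-vacuity: both knits fire on explicit data with nonempty classes and NONZERO shells -/

section NonVacuity

open T4ShellMeasureLevels.Toy in
/-- **ROAD I FIRES NON-TRIVIALLY.**  One term `()` of unit weight per run and step, shell part `ϑ^K`, one slot at the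
top level with piece `ϑ^K`, `D = 1`, `ρ_j = ϑ^j` (`T4ShellMeasureLevels.Toy`): every binder of `n21_knit_levels` holds
(window depth `0`, count `1`, `D̄ = c₁ = 1`) and the knit delivers `ShellWeightBound` with the NONZERO weight
`Wsh K = 2ϑ^K` for `0 < ϑ < 1` — classes nonempty, weights `1 > 0`, shells `ϑ^K > 0`. [folklore] -/
theorem n21_knit_levels_nonvacuous (l₀ : ℝ) {ϑ : ℝ} (h0 : 0 < ϑ) (h1 : ϑ < 1) :
    ShellWeightBound l₀ T A A (sh ϑ) (sh ϑ) fun K => 2 * ϑ ^ K := by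
  have h := n21_knit_levels_geometric (N₁ := 0) (νbar := 1) (Dbar := 1) (c₁ := 1)
    (levelLedger l₀ h0.le h1.le) (levelLedger l₀ h0.le h1.le) liveWindow liveWindow
    (fun _ => le_rfl) (fun _ => le_rfl) h0 h1
    (fun j => show ϑ ^ j ≤ 1 * ϑ ^ j from (one_mul _).symm.le)
    (fun j => show ϑ ^ j ≤ 1 * ϑ ^ j from (one_mul _).symm.le)
  have e : (fun K : ℕ => (2 * ((((0 : ℕ) : ℝ) + 1) * 1 * 1 * 1 * ϑ⁻¹ ^ 0)) * ϑ ^ K) = fun K => 2 * ϑ ^ K := by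
    funext K; push_cast; ring
  rw [e] at h
  exact h

/-- The data of `n21_knit_levels_nonvacuous` are non-degenerate: nonempty classes, positive weights, positive shells,
positive delivered weight. [folklore] -/
theorem n21_knit_levels_nonvacuous_data {ϑ : ℝ} (h0 : 0 < ϑ) (K : ℕ) (t : ℝ) :
    (T4ShellMeasureLevels.Toy.T K).Nonempty ∧ 0 < T4ShellMeasureLevels.Toy.A K t () ∧
      0 < T4ShellMeasureLevels.Toy.sh ϑ K t () ∧ 0 < 2 * ϑ ^ K :=
  ⟨⟨(), by simp [T4ShellMeasureLevels.Toy.T]⟩, by simp [T4ShellMeasureLevels.Toy.A],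
    by simpa [T4ShellMeasureLevels.Toy.sh] using pow_pos h0 K, by positivity⟩

/-- **ROAD II FIRES NON-TRIVIALLY.**  Window `N = 0`, one slot of age `0` (`n 0 = 1`), one term of unit weight per
step with shell part `ϑ^K` equal to the slot's piece, ratio `x 0 K = ϑ^K`, suppression exponent `p = 0`, level gain
`y j = ϑ^j` (summable for `0 ≤ ϑ < 1`): every binder of `n21_knit_ages` holds and the delivered weight is
`Σ_{a ≤ 0} 1·(e^0·ϑ^{K−a}) = ϑ^K`. [folklore] -/
theorem n21_knit_ages_nonvacuous (l₀ : ℝ) {ϑ : ℝ} (h0 : 0 ≤ ϑ) (h1 : ϑ < 1) :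
    ShellWeightBound l₀ (fun _ => ({()} : Finset Unit)) (fun _ _ _ => (1 : ℝ)) (fun _ _ _ => (1 : ℝ))
      (fun K _ _ => ϑ ^ K) (fun K _ _ => ϑ ^ K)
      fun K => ∑ a ∈ range (0 + 1), ((1 : ℕ) : ℝ) * (Real.exp (-(0 : ℝ)) * ϑ ^ (K - a)) := by
  have hy : Summable fun j : ℕ => ϑ ^ j := summable_geometric_of_lt_one h0 h1
  have hL : AgeLedger l₀ (fun _ => ({()} : Finset Unit)) (fun _ _ _ => (1 : ℝ)) 0 (fun _ => 1)
      (fun _ K _ _ => ϑ ^ K) (fun _ K => ϑ ^ K) :=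
    { piece_nonneg := fun _ _ K _ _ _ _ => pow_nonneg h0 K
      piece_le := fun _ _ K _ _ _ _ => pow_le_one₀ h0 h1.le
      ratio := fun _ _ K _ _ => by simp }
  have hu : ∀ (K : ℕ) (t : ℝ), |t| ≤ l₀ → ∀ τ ∈ ({()} : Finset Unit),
      ϑ ^ K ≤ ∑ σ ∈ (range (0 + 1)).sigma (fun a => range ((fun _ : ℕ => 1) a)), (fun _ K _ _ => ϑ ^ K) σ K t τ := by
    intro K t _ τ _
    simp
  exact n21_knit_ages (p := fun _ => 0) (y := fun j => ϑ ^ j) hL hL (fun K _ _ _ _ => pow_nonneg h0 K)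
    (fun K _ _ _ _ => pow_le_one₀ h0 h1.le) hu (fun K _ _ _ _ => pow_nonneg h0 K)
    (fun K _ _ _ _ => pow_le_one₀ h0 h1.le) hu
    ⟨fun a ha K => ⟨pow_nonneg h0 K, by
      have : a = 0 := Nat.le_zero.1 ha
      subst this; simp⟩, fun j => pow_nonneg h0 j, hy⟩

/-- … and road II's delivered weight on that data is exactly `ϑ^K`. [folklore] -/
theorem n21_knit_ages_nonvacuous_weight (ϑ : ℝ) (K : ℕ) :
    ∑ a ∈ range (0 + 1), ((1 : ℕ) : ℝ) * (Real.exp (-(0 : ℝ)) * ϑ ^ (K - a)) = ϑ ^ K := by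
  simp

end NonVacuity

end Summit.QuantumFields.YangMills.Theorems

end
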